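/-
Copyright (c) 2026 the pub-hodgecm-mathlib formalisation cell (harness21).  Prover seat hodgecm-mathlib-K2E1-p11 (g3), Track B ∕ K2-LIT, h413 = `stmt-HodgeConjecture-24833`,
R90-TF section S8 «ContSpec-n½», #2 road (G side), S8 dealer R90-CS-plan (g2) S8-R87 (4) «COST REDUCER adopted as the S8 road: every K-type twin of a level letter = ONE generic Hilbert lemma
+ block `K_∞`-stability»: THAT generic lemma — an orthogonal projection preserving every member of a family of subspaces maps the closure of their span into the closure of the span of
their cuts.
-/
import Mathlib.Analysis.InnerProductSpace.Projection.Submodule   -- Mathlib `Submodule.starProjection`, `starProjection_eq_self_iff`, `starProjection_apply_mem`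
import HarnessLib

/-!
# S8 #2 road (G side) — `R90S8ProjectionCommutesSupClosure`: an ORTHOGONAL PROJECTION `P_K` with `P_K(S_b) ⊆ S_b` for every `b` satisfies `cl(⨆_b S_b) ⊓ K ≤ cl ⨆_b (S_b ⊓ K)` —
# the ONE generic Hilbert lemma that turns every LEVEL letter of the (E)-road into its K-TYPE twin (S8-R87 (4))

Track B ∕ K2-LIT, crux h413 = `stmt-HodgeConjecture-24833`, route of record `HCCMUnconditional`; cell `hodgecm-mathlib`, R90-TF programme, section S8 «ContSpec-n½», socket #2's ED. 5
sub-socket (E) `sock_S8_res_exhaustion_le_closure` at the K-TYPE index (S8-R82 ∕ S8-R87).  THEOREMS ONLY, PURE MATHLIB (no tree import beyond `HarnessLib`; no `def`, no `instance`, no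
`notation`, no named-fact hypothesis, no `sorry`); lane `--supports stmt-HodgeConjecture-24833 --as helper` (count-neutral).  CLOSES NO SOCKET.

THE USE (S8-R87 (4)).  On `L²(U_{L/L⁺}(3))` let `K = Iso_τ` be a `K_∞`-isotypic component (closed; `P_K` = ★ `Schur.charProj` by ★ `charProj_eq_starProjection_isotypicComponent`) and `S_b` the
finite-level blocks ★ `resGBlock (ι_f Kf) 1 b` (or atoms ∕ lines).  Each `S_b` is `K_∞`-stable, hence `P_K(S_b) ⊆ S_b` (a letter per block); then the LEVEL exhaustion
`(L²_cusp)ᗮ ⊓ Fix(Kf) ≤ cl ⨆_b S_b` yields the K-TYPE exhaustion `(L²_cusp)ᗮ ⊓ Iso(Kf, τ) ≤ cl ⨆_b (S_b ⊓ Iso_τ) = cl ⨆_b resGBlockK Iso_τ Kf b` by `inf_starProjection_le_topologicalClosure_iSup_inf`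
below — and likewise for (E_blk,₃)(O₃)(N₃): the ★ generic-index letters stand, the K-type layer is this glue [BrockerTomDieck1985 III (5.10); DeitmarEchterhoff2014 Prop. 7.3.3].
* §1 `map_starProjection_le_inf` — `P_K(S) ≤ S ⊓ K` when `P_K(S) ⊆ S`; `iSup_map_starProjection_le` — the family form.
* §2 **`topologicalClosure_iSup_inf_le`** — `cl(⨆_b S_b) ⊓ K ≤ cl ⨆_b (S_b ⊓ K)` (the image of a closure under the continuous `P_K` lies in the closure of the image; on `K` the projection is the
  identity); **`inf_le_topologicalClosure_iSup_inf_of_le`** — consumer form: `T ≤ cl ⨆_b S_b` ⟹ `T ⊓ K ≤ cl ⨆_b (S_b ⊓ K)`.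
HONEST LABEL: HC_CM is proved only modulo the 7 printed citations (2 remaining named inputs: hLiu418 = `stmt-HodgeConjecture-24832`, h413 = `stmt-HodgeConjecture-24833`) until rung 0
closes; REL ≠ ★ ≠ BUILT; elementary Hilbert-space glue, closes no socket; count-neutral.
-/

set_option autoImplicit false
set_option linter.dupNamespace false  -- the mandated namespace `…HodgeConjecture.HodgeConjecture.R90.S8` (LEAD #1 L1) repeats the summit's segment

noncomputable section

namespace Summit.HodgeConjecture.HodgeConjecture.R90.S8

variable {E : Type*} [NormedAddCommGroup E] [InnerProductSpace ℂ E] (K : Submodule ℂ E) [K.HasOrthogonalProjection]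

/-! ## §1 A projection preserving `S` maps it into `S ⊓ K` -/

/-- **`P_K(S) ≤ S ⊓ K` as soon as `P_K(S) ⊆ S`** (the image of the orthogonal projection always lies in `K`, Mathlib `Submodule.starProjection_apply_mem`). [cite: DeitmarEchterhoff2014, Prop. 7.3.3] -/
theorem map_starProjection_le_inf (S : Submodule ℂ E) (hS : ∀ v ∈ S, K.starProjection v ∈ S) :
    S.map (K.starProjection : E →ₗ[ℂ] E) ≤ S ⊓ K := by
  rintro _ ⟨v, hv, rfl⟩
  exact ⟨hS v hv, K.starProjection_apply_mem v⟩

/-- **Family form**: `P_K(⨆_b S_b) ≤ ⨆_b (S_b ⊓ K)` when `P_K` preserves every `S_b` (Mathlib `Submodule.map_iSup`). [cite: DeitmarEchterhoff2014, Prop. 7.3.3] -/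
theorem iSup_map_starProjection_le {ι : Sort*} (S : ι → Submodule ℂ E) (hS : ∀ b, ∀ v ∈ S b, K.starProjection v ∈ S b) :
    (⨆ b, S b).map (K.starProjection : E →ₗ[ℂ] E) ≤ ⨆ b, (S b ⊓ K) := by
  rw [Submodule.map_iSup]
  exact iSup_mono fun b => map_starProjection_le_inf K (S b) (hS b)

/-! ## §2 The glue: `cl(⨆_b S_b) ⊓ K ≤ cl ⨆_b (S_b ⊓ K)` -/

/-- **THE K-TYPE GLUE — `cl(⨆_b S_b) ⊓ K ≤ cl ⨆_b (S_b ⊓ K)` for an orthogonal projection `P_K` preserving every `S_b`**: a vector `v` of `K` in the closure of `⨆ S_b` is `P_K v`, and `P_K`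
(continuous) maps `cl(⨆ S_b)` into `cl(P_K(⨆ S_b)) ⊆ cl ⨆ (S_b ⊓ K)` (§1). [cite: BrockerTomDieck1985, III (5.10)] [cite: DeitmarEchterhoff2014, Prop. 7.3.3] -/
theorem topologicalClosure_iSup_inf_le {ι : Sort*} (S : ι → Submodule ℂ E) (hS : ∀ b, ∀ v ∈ S b, K.starProjection v ∈ S b) :
    (⨆ b, S b).topologicalClosure ⊓ K ≤ (⨆ b, S b ⊓ K).topologicalClosure := by
  rintro v ⟨hv, hvK⟩
  have hPv : K.starProjection v = v := K.starProjection_eq_self_iff.mpr hvK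
  rw [← hPv]
  -- `P_K` maps the closure of `⨆ S_b` into the closure of its image, which lies in `cl ⨆ (S_b ⊓ K)`
  have himg : (K.starProjection : E → E) '' ((⨆ b, S b : Submodule ℂ E) : Set E) ⊆ ((⨆ b, S b ⊓ K : Submodule ℂ E) : Set E) := by
    rintro _ ⟨w, hw, rfl⟩
    exact iSup_map_starProjection_le K S hS ⟨w, hw, rfl⟩
  have hcl : (K.starProjection : E → E) '' closure ((⨆ b, S b : Submodule ℂ E) : Set E) ⊆ closure (((⨆ b, S b ⊓ K : Submodule ℂ E) : Set E)) :=
    (image_closure_subset_closure_image K.starProjection.continuous).trans (closure_mono himg)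
  exact hcl ⟨v, hv, rfl⟩

/-- **Consumer form**: if `T ≤ cl ⨆_b S_b` (a LEVEL letter, e.g. exhaustion `(L²_cusp)ᗮ ⊓ Fix(Kf) ≤ cl ⨆_b Sc_b`) and `P_K` preserves every `S_b` (`K_∞`-stability of the blocks), then
`T ⊓ K ≤ cl ⨆_b (S_b ⊓ K)` (its K-TYPE twin, e.g. at `K := Iso_τ`, `S_b ⊓ K = resGBlockK Iso_τ Kf b`). [cite: BrockerTomDieck1985, III (5.10)] [cite: MoeglinWaldspurger1995, II.2.4] -/
theorem inf_le_topologicalClosure_iSup_inf_of_le {ι : Sort*} (S : ι → Submodule ℂ E) (hS : ∀ b, ∀ v ∈ S b, K.starProjection v ∈ S b)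
    (T : Submodule ℂ E) (hT : T ≤ (⨆ b, S b).topologicalClosure) :
    T ⊓ K ≤ (⨆ b, S b ⊓ K).topologicalClosure :=
  (inf_le_inf_right K hT).trans (topologicalClosure_iSup_inf_le K S hS)

/-- **Consumer form, both sides cut**: `T ≤ cl ⨆_b S_b` ⟹ `T ⊓ K ≤ cl ⨆_b (S_b ⊓ K)`, stated with the hypothesis already cut (`T ⊓ K` on the left arises as `Iso (Kf, τ) = Fix(Kf) ⊓ Iso_τ`).
[cite: DeitmarEchterhoff2014, Prop. 7.3.3] -/
theorem inf_starProjection_le_topologicalClosure_iSup_inf {ι : Sort*} (S : ι → Submodule ℂ E) (hS : ∀ b, ∀ v ∈ S b, K.starProjection v ∈ S b)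
    (T R : Submodule ℂ E) (hT : R ⊓ T ≤ (⨆ b, S b).topologicalClosure) :
    R ⊓ (T ⊓ K) ≤ (⨆ b, S b ⊓ K).topologicalClosure := by
  rw [← inf_assoc]
  exact inf_le_topologicalClosure_iSup_inf_of_le K S hS (R ⊓ T) hT

end Summit.HodgeConjecture.HodgeConjecture.R90.S8

end
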